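import Summits.ResolutionOfSingularities.ResolutionOfSingularities.Theorems.PAlterationPalterationThesisRRLU1OfLuAlphaPTorsor
import Summits.ResolutionOfSingularities.ResolutionOfSingularities.Theorems.PAlterationPalterationThesisPerfectTransfer
import Summits.ResolutionOfSingularities.ResolutionOfSingularities.Theorems.PAlterationPialtSplitGlue
import Summits.ResolutionOfSingularities.ResolutionOfSingularities.Theorems.PAlterationPalterationThesisGlue
import Summits.ResolutionOfSingularities.ResolutionOfSingularities.Theses.Valuative
import Summits.ResolutionOfSingularities.ResolutionOfSingularities.Theses.Descent
import HarnessLib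

/-!
# `PalterationThesis` (crux stmt-ResolutionOfSingularities-0552), line `Sketch` rev. c5: the display —
# the crux from item 0641, the fact `Temkin2013`, two-model patching over PERFECT fields, and item 0549

Certification file of the line lead (c5) for the skeleton
`Cruxes/PalterationThesis/Lines/Sketch.lean` rev. c5 (`--supports stmt-0552`; it does not close
the item). The skeleton's four `sorry`s are `stub_luAlphaPTorsor : Valuative.LuAlphaPTorsor`
(item stmt-0641 by name), `stub_temkin2013 : Temkin2013` (the named fact by name),
`stub_twoModelPatchingPerfect` (`ProperModel.TwoModelPatching p` sliced at perfect ground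
fields — the open core of crux stmt-0642) and `stub_descentPerfectToAll : Descent.DescentPerfectToAll`
(item stmt-0549 by name). This file proves, sorry-free, that they compose to the crux BY NAME,
and records the two by-products for the sibling cruxes of the route:

* `hasResolution_perfectField_of_temkin2013_luAlphaPTorsor_twoModelPatchingPerfect` — weak
  resolution over every PERFECT field of characteristic `p` from `Temkin2013`, the torsor crux
  at `p` and two-model patching over perfect fields of characteristic `p` (the RRLU1 input of
  item 0555's split glue is supplied by `rrLU1At_of_luAlphaPTorsorAt`, p141724);
* `pialt_of_temkin2013_luAlphaPTorsor_twoModelPatchingPerfect` — hence the crux `Pialt`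
  (stmt-0555) over EVERY field from `Temkin2013`, `LuAlphaPTorsor` and two-model patching over
  PERFECT fields only (`Pialt` descends to perfect ground fields, `pialt_of_pialt_perfectField`,
  lead a2) — a new by-name edge for `PAlterationPialtCruxMap.lean`, whose route-Valuative entries
  need `PatchingRel` over all fields;
* `palterationThesis_of_luAlphaPTorsor_temkin2013_twoModelPatchingPerfect_descent` (registered
  sub-goal) — the crux from the four rev. c5 stubs, i.e. the skeleton's `PalterationThesis_of`
  with its stubs as hypotheses.

Sources: M. Temkin, J. Algebra 373 (2013), Thm. 1.3.2 and Rem. 1.3.5; O. Piltant, RACSAM 107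
(2013), Prop. 5.1, Cor. 5.7; O. Zariski, Ann. of Math. 41 (1940) / 45 (1944).
-/

set_option linter.dupNamespace false -- mandated namespace of this single-conjunct summit

noncomputable section

open CategoryTheory AlgebraicGeometry
open Literature.AlgebraicGeometry.Resolution
open Summit.ResolutionOfSingularities.ResolutionOfSingularities
open Summit.ResolutionOfSingularities.ResolutionOfSingularities.Theorems.Pialt.RadiciallyRegular
  (hasResolution_perfectField_of_temkin2013_rrLU1Perfect_twoModelPatchingPerfect
    pialt_of_temkin2013_rrLU1Perfect_twoModelPatchingPerfect)
open Summit.ResolutionOfSingularities.ResolutionOfSingularities.Theorems.PalterationThesis.PerfectTransfer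
  (palterationThesis_iff_perfect_and_descent pialtOver_and_picoverOver_iff_perfectField)

namespace Summit.ResolutionOfSingularities.ResolutionOfSingularities.Theorems.PalterationThesis.PerfectAtoms

/-- **Weak resolution over a PERFECT field of characteristic `p` from `Temkin2013`, the torsor
crux at `p`, and two-model patching over perfect fields of characteristic `p`.** The RRLU1 input
of `hasResolution_perfectField_of_temkin2013_rrLU1Perfect_twoModelPatchingPerfect` (item 0555's
split glue: Temkin's top chart, one-step radicial descents, Zariski–Piltant patching) is
`rrLU1At_of_luAlphaPTorsorAt` (Frobenius transport + torsor tower).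
[cite: Temkin2013, Thm. 1.3.2 and Rem. 1.3.5 (i)–(ii); Piltant2013, Prop. 5.1 and Cor. 5.7] -/
theorem hasResolution_perfectField_of_temkin2013_luAlphaPTorsor_twoModelPatchingPerfect
    (hT : Temkin2013.{0}) {p : ℕ} [Fact p.Prime]
    (hLu : ∀ (k M : Type) [Field k] [CharP k p] [Field M] [Algebra k M] (O : ValuationSubring M)
      (A₀ : Subalgebra k M) (h₀ : A₀.toSubring ≤ O.toSubring) (t : M), A₀.FG → t ^ p ∈ A₀ →
      IsFractionRing (Algebra.adjoin k (insert t (A₀ : Set M))) M →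
      IsRegularLocalRing (Localization.AtPrime
        (Ideal.comap (Subring.inclusion h₀) (IsLocalRing.maximalIdeal O))) →
      ∃ (A : Subalgebra k M) (h : A.toSubring ≤ O.toSubring), A₀ ≤ A ∧ t ∈ A ∧ A.FG ∧
        IsFractionRing A M ∧
        IsRegularLocalRing (Localization.AtPrime
          (Ideal.comap (Subring.inclusion h) (IsLocalRing.maximalIdeal O))))
    (hZ : ∀ (k : Type) [Field k] [CharP k p] [PerfectField k] (K : Type) [Field K] [Algebra k K]
      [Algebra.EssFiniteType k K], ∀ M₁ M₂ : ProperModel k K,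
        ∃ (N : ProperModel k K) (φ₁ : N.Hom M₁) (φ₂ : N.Hom M₂), φ₁.RegLe ∧ φ₂.RegLe)
    (k : Type) [Field k] [CharP k p] [PerfectField k] (X : Scheme.{0}) (f : X ⟶ Spec (.of k))
    [IsSeparated f] [LocallyOfFiniteType f] [QuasiCompact f] [IsReduced X] :
    Scheme.HasResolution X :=
  hasResolution_perfectField_of_temkin2013_rrLU1Perfect_twoModelPatchingPerfect hT
    (fun k' K L _ _ _ _ _ _ _ _ _ => rrLU1At_of_luAlphaPTorsorAt p Fact.out k' hLu K L) hZ k X f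

/-- **`Pialt` (crux stmt-0555) over EVERY field from `Temkin2013`, `LuAlphaPTorsor` (item
stmt-0641) and two-model patching over PERFECT fields of every prime characteristic** — by name;
`Pialt` descends to perfect ground fields (`pialt_of_pialt_perfectField`, inside item 0555's
split glue `pialt_of_temkin2013_rrLU1Perfect_twoModelPatchingPerfect`), and over a perfect field
the RRLU1 input is `rrLU1At_of_luAlphaPTorsor`.
[cite: Temkin2013, Thm. 1.3.2 and Rem. 1.3.5 (i)–(ii); Piltant2013, Prop. 5.1] -/
theorem pialt_of_temkin2013_luAlphaPTorsor_twoModelPatchingPerfect (hT : Temkin2013.{0})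
    (hLu : Theses.Valuative.LuAlphaPTorsor)
    (hZ : ∀ p : ℕ, p.Prime → ∀ (k : Type) [Field k] [CharP k p] [PerfectField k] (K : Type)
      [Field K] [Algebra k K] [Algebra.EssFiniteType k K], ∀ M₁ M₂ : ProperModel k K,
        ∃ (N : ProperModel k K) (φ₁ : N.Hom M₁) (φ₂ : N.Hom M₂), φ₁.RegLe ∧ φ₂.RegLe) :
    Theses.PAlteration.Pialt :=
  pialt_of_temkin2013_rrLU1Perfect_twoModelPatchingPerfect hT
    (fun p hp k K L _ _ _ _ _ _ _ _ _ => rrLU1At_of_luAlphaPTorsor hLu p hp k K L) hZ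

/-- **The rev. c5 display of the skeleton `Sketch`: the crux BY NAME from its four stubs** —
`LuAlphaPTorsor` (item stmt-0641), the named fact `Temkin2013`, two-model patching of proper
models over PERFECT fields of every prime characteristic (the open core of crux stmt-0642,
sliced), and `DescentPerfectToAll` (item stmt-0549): perfect-field transfer
(`palterationThesis_iff_perfect_and_descent`), the fieldwise sandwich
(`pialtOver_and_picoverOver_iff_perfectField`) and weak resolution over each perfect field
(`hasResolution_perfectField_of_temkin2013_luAlphaPTorsor_twoModelPatchingPerfect`). Registered
sub-goal of crux stmt-0552. [cite: Temkin2013, Thm. 1.3.2 and Rem. 1.3.5; Piltant2013, Prop. 5.1] -/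
theorem palterationThesis_of_luAlphaPTorsor_temkin2013_twoModelPatchingPerfect_descent (hLu : Summit.ResolutionOfSingularities.ResolutionOfSingularities.Theses.Valuative.LuAlphaPTorsor) (hT : Literature.AlgebraicGeometry.Resolution.Temkin2013.{0}) (hZ : ∀ p : ℕ, p.Prime → ∀ (k : Type) [Field k] [CharP k p] [PerfectField k] (K : Type) [Field K] [Algebra k K] [Algebra.EssFiniteType k K], ∀ M₁ M₂ : Literature.AlgebraicGeometry.Resolution.ProperModel k K, ∃ (N : Literature.AlgebraicGeometry.Resolution.ProperModel k K) (φ₁ : N.Hom M₁) (φ₂ : N.Hom M₂), φ₁.RegLe ∧ φ₂.RegLe) (hD : Summit.ResolutionOfSingularities.ResolutionOfSingularities.Theses.Descent.DescentPerfectToAll) : Summit.ResolutionOfSingularities.ResolutionOfSingularities.Theses.PAlteration.PalterationThesis :=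
  palterationThesis_iff_perfect_and_descent.mpr
    ⟨fun p hp K _ _ _ =>
        (pialtOver_and_picoverOver_iff_perfectField p hp K).mpr fun X f hs hl hq hr => by
          haveI : Fact p.Prime := ⟨hp⟩
          haveI := hs; haveI := hl; haveI := hq; haveI := hr
          exact hasResolution_perfectField_of_temkin2013_luAlphaPTorsor_twoModelPatchingPerfect
            hT (hLu p hp) (hZ p hp) K X f,
      hD⟩

end Summit.ResolutionOfSingularities.ResolutionOfSingularities.Theorems.PalterationThesis.PerfectAtoms

end
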